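import Summits.Langlands.Langlands.Theorems.PhantomRMYoshidaResiduallyYoshidaLiftingNonsplitInvariantSubspaces
import HarnessLib
import Mathlib.Data.Matrix.ColumnRowPartitioned

/-!
# Orientation of a stable residual plane (stub `stub_residualPlaneOrientation`) — line `sector-klingen-split`

Stub-worker of lead prover-line-stmt-Langlands-13639-c4-0 (cycle 4, 2026-08-17).  ORIENTATION RIGIDITY, residual half:
for `σ, σ' : Γ → GL₂(k)` irreducible and `B` not a coboundary, put `ρ̄ g := h (σ g, B g; 0, σ' g) h⁻¹` on `k⁴` (blocks along
`finSumFinEquiv : Fin 2 ⊕ Fin 2 ≃ Fin 4`).  If a rank-`2` matrix `N : k^{4 × 2}` spans a `ρ̄`-stable plane with action matrices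
`T g` (`ρ̄ g N = N T g`), then `T` is conjugate to `σ` (never to `σ'`): transporting the column span of `h⁻¹ N` to `k² ⊕ k²`,
the invariant-subspace trichotomy `Ribet.stub_nonsplitInvariantSubspaces` (p152467) leaves only the `σ`-plane `k² ⊕ 0` in
dimension `2`; so the lower block of `h⁻¹ N` vanishes, its upper block `A₀` is invertible (rank `2`), and the top block row of
`(σ g, B g; 0, σ' g) (A₀; 0) = (A₀; 0) T g` reads `σ g A₀ = A₀ T g`.
-/

noncomputable section

open scoped Matrix

set_option linter.dupNamespace false
set_option autoImplicit false

namespace Summit.Langlands.Langlands.Cruxes.ResiduallyYoshidaLifting.SectorKlingenSplit.Fibre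

open Literature.NumberTheory.GaloisRepresentations

/-- **Registered statement `stub_residualPlaneOrientation`** (ORIENTATION RIGIDITY, residual half): a plane of `k⁴` (column
span of a rank-`2` matrix `N`) stable under the realised non-split `h (σ, B; 0, σ') h⁻¹` carries an action `T` CONJUGATE TO `σ`
(not to `σ'`): the invariant-subspace trichotomy leaves only the `σ`-plane in dimension `2`. [folklore] -/
theorem stub_residualPlaneOrientation :
    ∀ (k : Type) [Field k] (Γ : Type) [Group Γ] (σ σ' : Γ →* GL (Fin 2) k),
      Representation.IsIrreducible ((glStdRepresentation (Fin 2) k).comp σ) →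
      Representation.IsIrreducible ((glStdRepresentation (Fin 2) k).comp σ') →
      ∀ (B : Γ → Matrix (Fin 2) (Fin 2) k),
      (¬ ∃ X : Matrix (Fin 2) (Fin 2) k, ∀ g, B g = (σ g).val * X - X * (σ' g).val) →
      ∀ (h : GL (Fin 4) k) (N : Matrix (Fin 4) (Fin 2) k) (T : Γ → Matrix (Fin 2) (Fin 2) k),
      (∀ a : Fin 2 → k, N *ᵥ a = 0 → a = 0) →
      (∀ g, h.val * Matrix.reindex finSumFinEquiv finSumFinEquiv
            (Matrix.fromBlocks (σ g).val (B g) 0 (σ' g).val) * (h⁻¹).val * N = N * T g) →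
      ∃ A : GL (Fin 2) k, ∀ g, (σ g).val * A.val = A.val * T g := by
  intro k _ Γ _ σ σ' hσ hσ' B hB h N T hN hT
  -- (1) the plane of `N' := h⁻¹ N` is stable under the block matrices themselves: `M g N' = N' T g`
  have hN' : ∀ g, Matrix.reindex finSumFinEquiv finSumFinEquiv (Matrix.fromBlocks (σ g).val (B g) 0 (σ' g).val) *
      ((h⁻¹).val * N) = (h⁻¹).val * N * T g := fun g => by
    have e1 : (h⁻¹).val * (h.val * Matrix.reindex finSumFinEquiv finSumFinEquiv
        (Matrix.fromBlocks (σ g).val (B g) 0 (σ' g).val) * (h⁻¹).val * N) = (h⁻¹).val * (N * T g) := by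
      rw [hT g]
    simpa only [← Matrix.mul_assoc, Units.inv_mul, Matrix.one_mul] using e1
  -- (2) transport `N'` along `finSumFinEquiv` to `P : k^{(2 ⊕ 2) × 2}`; then `(σ g, B g; 0, σ' g) P = P T g`
  obtain ⟨P, hPdef⟩ : ∃ P : Matrix (Fin 2 ⊕ Fin 2) (Fin 2) k,
      P = ((h⁻¹).val * N).submatrix finSumFinEquiv id := ⟨_, rfl⟩
  have hP : ∀ g, Matrix.fromBlocks (σ g).val (B g) 0 (σ' g).val * P = P * T g := fun g => by
    have e2 : (Matrix.reindex finSumFinEquiv finSumFinEquiv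
        (Matrix.fromBlocks (σ g).val (B g) 0 (σ' g).val)).submatrix finSumFinEquiv finSumFinEquiv =
        Matrix.fromBlocks (σ g).val (B g) 0 (σ' g).val := by
      rw [Matrix.reindex_apply, Matrix.submatrix_submatrix, Equiv.symm_comp_self, Matrix.submatrix_id_id]
    rw [← e2, hPdef, Matrix.submatrix_mul_equiv, hN' g,
      Matrix.submatrix_mul _ (T g) _ id id Function.bijective_id, Matrix.submatrix_id_id]
  -- `P` has rank `2`
  have hPmul : ∀ a : Fin 2 → k, P *ᵥ a = (((h⁻¹).val * N) *ᵥ a) ∘ finSumFinEquiv := fun a => by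
    rw [hPdef]
    rfl
  have hPinj : ∀ a : Fin 2 → k, P *ᵥ a = 0 → a = 0 := fun a ha => by
    have h1 : ((h⁻¹).val * N) *ᵥ a = 0 := by
      funext l
      have e3 := congrFun ha (finSumFinEquiv.symm l)
      rw [hPmul] at e3
      simpa only [Function.comp_apply, Equiv.apply_symm_apply, Pi.zero_apply] using e3
    apply hN a
    calc N *ᵥ a = h.val *ᵥ (((h⁻¹).val * N) *ᵥ a) := by
          rw [Matrix.mulVec_mulVec, ← Matrix.mul_assoc, Units.mul_inv, Matrix.one_mul]
      _ = 0 := by rw [h1, Matrix.mulVec_zero]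
  -- (3) the column span `W` of `P` is a stable subspace of `k² ⊕ k²` of dimension `≤ 2`
  obtain ⟨W, hWmem, hWrank⟩ : ∃ W : Submodule k (Fin 2 ⊕ Fin 2 → k),
      (∀ w, w ∈ W ↔ ∃ a, P *ᵥ a = w) ∧ Module.finrank k W ≤ 2 :=
    ⟨LinearMap.range (Matrix.mulVecLin P), fun w => LinearMap.mem_range,
      (LinearMap.finrank_range_le _).trans_eq (Module.finrank_fin_fun k)⟩
  have hstab : ∀ g, ∀ w ∈ W, (Matrix.fromBlocks (σ g).val (B g) 0 (σ' g).val).mulVec w ∈ W := by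
    intro g w hw
    obtain ⟨a, rfl⟩ := (hWmem w).mp hw
    refine (hWmem _).mpr ⟨T g *ᵥ a, ?_⟩
    rw [Matrix.mulVec_mulVec, Matrix.mulVec_mulVec, hP g]
  -- (4) the trichotomy: `W` is `⊥` (no: `P ≠ 0`), `⊤` (no: dimension), or the `σ`-plane
  rcases Ribet.stub_nonsplitInvariantSubspaces k Γ σ σ' hσ hσ' B hB W hstab with hWbot | hWtop | hW3
  · exfalso
    have h0 : P *ᵥ (fun _ => 1) = 0 := by
      have hm : P *ᵥ (fun _ => 1) ∈ W := (hWmem _).mpr ⟨_, rfl⟩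
      rwa [hWbot, Submodule.mem_bot] at hm
    have e0 := congrFun (hPinj _ h0) 0
    simp at e0
  · exfalso
    rw [hWtop, finrank_top, Module.finrank_fintype_fun_eq_card, Fintype.card_sum, Fintype.card_fin] at hWrank
    omega
  · -- the lower block of `P` vanishes, the upper block `A₀ := P.toRows₁` is invertible and intertwines `σ` with `T`
    have hlow : ∀ a : Fin 2 → k, ∀ j : Fin 2, (P *ᵥ a) (Sum.inr j) = 0 := fun a =>
      (hW3 _).mp ((hWmem _).mpr ⟨a, rfl⟩)
    have hP2 : P.toRows₂ = 0 := by
      refine Matrix.ext_iff_mulVec.mpr fun a => ?_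
      rw [Matrix.zero_mulVec]
      funext j
      exact hlow a j
    have hPrw : Matrix.fromRows P.toRows₁ 0 = P := by
      rw [← hP2, Matrix.fromRows_toRows]
    have hA₀ : ∀ g, (σ g).val * P.toRows₁ = P.toRows₁ * T g := fun g => by
      have e4 := hP g
      rw [← hPrw, Matrix.fromBlocks_mul_fromRows, Matrix.fromRows_mul] at e4
      simpa using congrArg Matrix.toRows₁ e4
    have hA₀inj : Function.Injective P.toRows₁.mulVec := by
      refine (injective_iff_map_eq_zero (Matrix.mulVecLin P.toRows₁)).mpr fun a ha => hPinj a ?_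
      rw [Matrix.mulVecLin_apply] at ha
      rw [← hPrw, Matrix.fromRows_mulVec, Matrix.zero_mulVec, ha, Sum.elim_zero_zero]
    have hunit : IsUnit P.toRows₁ := Matrix.mulVec_injective_iff_isUnit.mp hA₀inj
    exact ⟨hunit.unit, fun g => by rw [IsUnit.unit_spec]; exact hA₀ g⟩

end Summit.Langlands.Langlands.Cruxes.ResiduallyYoshidaLifting.SectorKlingenSplit.Fibre

end
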